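import Mathlib
import Summits.NavierStokesRegularity.NavierStokesRegularity.Theses.MarginalTypeI
import Literature.Barriers.NavierStokesRegularity.ContinuityMethodClosedness
import Summits.NavierStokesRegularity.NavierStokesRegularity.Theorems.HeredityFromTwo.Negative.KatoLargeData
import HarnessLib

/-!
# `MarginalTypeI.CriticalViscosityExists` — the critical viscosity of a Clay datum without a
  global Kato solution (route `MarginalTypeI`, item stmt-NavierStokesRegularity-1750, support;
  the card's threshold package T1 in viscosity form)

**Statement.** If a Clay datum `u₀` (smooth, divergence free, rapidly decaying) has no global Kato
solution at viscosity `ν > 0`, then `ν_c := sup{ν' ≥ ν : ¬HasGlobalKatoSolution ν' u₀}` is finite,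
attained (`¬HasGlobalKatoSolution ν_c u₀`), and every `ν' > ν_c` is global.

PROOF. The set is bounded by Kato's small-data theorem (`kato_global_small_holds`, PROVED in the
tree: `‖u₀‖_{L³} ≤ δν'` for `ν' ≥ ‖u₀‖₃/δ`), so the supremum exists; `ν' > ν_c` is outside the set,
hence global; and `ν_c` itself is not global because the set of global viscosities is OPEN:
by the viscosity scaling `HasGlobalKatoSolution ν' u₀ ↔ HasGlobalKatoSolution ν_c ((ν_c/ν')u₀)`
(`hasGlobalKatoSolution_smul_iff`) this is the openness of `{s : s u₀ ∈ G_{ν_c}}`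
(`isOpen_ray_hasGlobalKatoSolution`, i.e. Gallagher–Iftimie–Planchon 2003, Thm. 0.1, PROVED in
the tree as `GIP2003_L3_stability_holds`), and members of the set accumulate at `ν_c` from below.
A Clay datum is in `L³` (`PalasekTowerClayBridge.memLp_three_of_hasRapidSpatialDecay`) and weakly divergence free.

HONEST FRAMING: a statement about a HYPOTHETICAL non-global datum; nothing here bears on the
regularity problem itself.
-/

noncomputable section

set_option linter.dupNamespace false

namespace Summit.NavierStokesRegularity.NavierStokesRegularity.Theorems

open MeasureTheory Set Filter Topology Function Metric
open Literature.Analysis Literature.Analysis.FluidPDE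
open Literature.Barriers.NavierStokesRegularity

/-- **Item stmt-NavierStokesRegularity-1750** (`MarginalTypeI.CriticalViscosityExists`): a Clay
datum without a global Kato solution at viscosity `ν` has a critical viscosity `ν_c ≥ ν` — not
global at `ν_c`, global above it (Kato small data + GIP openness + scaling). [this file;
GallagherIftimiePlanchon2003 Thm 0.1, Kato1984] -/
theorem marginalTypeI_criticalViscosityExists_proof :
    Summit.NavierStokesRegularity.NavierStokesRegularity.Theses.MarginalTypeI.CriticalViscosityExists := by
  unfold Summit.NavierStokesRegularity.NavierStokesRegularity.Theses.MarginalTypeI.CriticalViscosityExists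
  intro ν hν u₀ hsm hdiv hdec hnot
  have hL3 : MemLp u₀ 3 volume :=
    Summit.NavierStokesRegularity.FluidComputer.PalasekTowerClayBridge.memLp_three_of_hasRapidSpatialDecay
      hsm.continuous hdec
  have hwdf : IsWeaklyDivFree u₀ :=
    VectorCalculus.IsDivFree.isWeaklyDivFree_holds hdiv (hsm.of_le (by exact_mod_cast le_top))
  -- large viscosities are global (Kato's small-data theorem)
  obtain ⟨δ, hδ, hkato⟩ := kato_global_small_holds
  set N : ℝ := (eLpNorm u₀ 3 volume).toReal with hN
  have hN0 : 0 ≤ N := ENNReal.toReal_nonneg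
  have hNe : eLpNorm u₀ 3 volume = ENNReal.ofReal N := by
    rw [hN, ENNReal.ofReal_toReal hL3.eLpNorm_ne_top]
  have hlarge : ∀ ν' : ℝ, N / δ < ν' → HasGlobalKatoSolution ν' u₀ := by
    intro ν' hν'
    have hν'pos : 0 < ν' := lt_of_le_of_lt (div_nonneg hN0 hδ.le) hν'
    have hsmall : eLpNorm u₀ 3 volume ≤ ENNReal.ofReal (δ * ν') := by
      rw [hNe]
      refine ENNReal.ofReal_le_ofReal ?_
      rw [div_lt_iff₀ hδ] at hν'
      linarith
    obtain ⟨u, hg, hcont, hu0, hm, -, -⟩ := hkato ν' hν'pos u₀ hL3 hwdf hsmall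
    exact ⟨u, hg, hcont, hu0, hm⟩
  -- the set of non-global viscosities above `ν` and its supremum
  set S : Set ℝ := {ν' | ν ≤ ν' ∧ ¬ HasGlobalKatoSolution ν' u₀} with hS
  have hνS : ν ∈ S := ⟨le_rfl, hnot⟩
  have hSbdd : BddAbove S := by
    refine ⟨N / δ, fun ν' hν' => ?_⟩
    by_contra h
    exact hν'.2 (hlarge ν' (not_le.1 h))
  set νc : ℝ := sSup S with hνc
  have hννc : ν ≤ νc := le_csSup hSbdd hνS
  have hνcpos : 0 < νc := hν.trans_le hννc
  refine ⟨νc, hννc, ?_, ?_⟩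
  · -- `ν_c` is not global: otherwise a neighbourhood of `ν_c` is global, against `ν_c = sup S`
    intro hK
    have hG : IsOpen {s : ℝ | HasGlobalKatoSolution νc (s • u₀)} :=
      isOpen_ray_hasGlobalKatoSolution hνcpos hL3 hwdf
    have h1G : νc / νc ∈ {s : ℝ | HasGlobalKatoSolution νc (s • u₀)} := by
      rw [div_self hνcpos.ne', mem_setOf_eq, one_smul]
      exact hK
    have hcts : ContinuousAt (fun ν' : ℝ => νc / ν') νc :=
      continuousAt_const.div continuousAt_id hνcpos.ne'
    have hpre : {ν' : ℝ | νc / ν' ∈ {s : ℝ | HasGlobalKatoSolution νc (s • u₀)}} ∈ 𝓝 νc :=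
      hcts.preimage_mem_nhds (hG.mem_nhds h1G)
    obtain ⟨ε', hε', hball⟩ := Metric.mem_nhds_iff.1 (inter_mem hpre (Ioi_mem_nhds hνcpos))
    obtain ⟨s, hsS, hslt⟩ := exists_lt_of_lt_csSup ⟨ν, hνS⟩ (show νc - ε' < νc by linarith)
    have hsle : s ≤ νc := le_csSup hSbdd hsS
    have hsball : s ∈ ball νc ε' := by
      rw [mem_ball, Real.dist_eq, abs_lt]
      constructor <;> linarith
    obtain ⟨hsG, hspos⟩ := hball hsball
    have hspos' : 0 < s := hspos
    have ha : 0 < νc / s := div_pos hνcpos hspos'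
    have hsG' : HasGlobalKatoSolution (νc / s * s) ((νc / s) • u₀) := by
      rw [div_mul_cancel₀ νc hspos'.ne']
      exact hsG
    have hK' : HasGlobalKatoSolution s u₀ := (hasGlobalKatoSolution_smul_iff ha).1 hsG'
    exact hsS.2 hK'
  · -- every `ν' > ν_c` is global
    intro ν' hν'
    by_contra hno
    have hmem : ν' ∈ S := ⟨hννc.trans hν'.le, hno⟩
    exact absurd (le_csSup hSbdd hmem) (not_le.2 hν')

end Summit.NavierStokesRegularity.NavierStokesRegularity.Theorems

end
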